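import Literature.Geometry.PolyhedralFans.RelativeProjectiveRefinementTight
import HarnessLib

/-!
# Regular projective subdivision of a conical complex presented by charts — the statement
# (Kempf–Knudsen–Mumford–Saint-Donat 1973, Ch. II §2: Theorems 4*, 9*, 11*; Kato 1994 (9.8))

Topic: `Literature/Geometry/PolyhedralFans`. [KempfEtAl1973] Ch. I §2 Thm. 11 subdivides ONE fan
(tree theorems `Fan.exists_regular_refinement`, `Fan.exists_regular_refinement_isStrictSupport_cones`);
Ch. II §1 Def. 5 / §2 carry the results over to ABSTRACT "conical polyhedral complexes with
integral structure" — finitely many rational cones glued along faces by lattice isomorphisms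
(loc. cit. p. 94: "Theorems 4*, 9*, 11* hold for conical polyhedral complexes") — which is the
form K. Kato, *Toric singularities*, Amer. J. Math. 116 (1994), (9.6)–(9.8) uses for the fan
`F(X)` of a log regular scheme covered by several charts. This file only STATES the chart
presentation of that result, in the vocabulary of the tree's embedded fans:

* `Fan.Link Δ` — a LINK of a fan `Δ ⊆ ℚ^κ`: two cones `src, tgt ∈ Δ.cones` and mutually inverse
  `ℚ`-linear maps identifying them together with their lattice points (in the application the
  cones of all charts live in disjoint coordinate blocks of one `ℚ^κ`, and the links are the
  identifications of faces along which the charts overlap; self-links of a block — monodromy —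
  are allowed);
* `Fan.LinkCompatible Δ₀ Δ' ℓ` — a refinement `Δ'` of `Δ₀` is compatible with the link `ℓ`: the
  link map carries the cones of `Δ'` inside `ℓ.src` to cones of `Δ'` inside `ℓ.tgt`;
* `Fan.LinkedRegularRefinement` — NAMED STATEMENT (KKMS II §2 Thm. 11* by charts): every rational
  fan `Δ₀ ⊆ ℚ^κ` with any set of links admits a refinement by lattice star subdivisions which is
  regular and simplicial, carries ONE function `f ≥ 0` that is an integral tight strictly convex
  support function on every cone of `Δ₀` (verbatim the conclusion of
  `Fan.exists_regular_refinement_isStrictSupport_cones`), and is COMPATIBLE WITH EVERY LINK: cones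
  correspond under the link maps and `f ∘ ℓ = f` on `ℓ.src`.

Proof route (not in this file; see the seat's LINKED-KKMS spec): barycentric subdivision first
(canonical, hence link-compatible; afterwards no cone contains two distinct link-equivalent
points), then the multiplicity descent of Ch. I Thm. 11 run simultaneously on link-orbits with a
multi-point version of Ch. I §2 Lemma 2 (one constant `M`, symmetric tent coefficients).

References: [KempfEtAl1973] G. Kempf, F. Knudsen, D. Mumford, B. Saint-Donat, Toroidal Embeddings I,
LNM 339 (1973), Ch. I §2 Thm. 11, Ch. II §1 Def. 5, §2; [Kato1994] K. Kato, Toric singularities,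
Amer. J. Math. 116 (1994), (9.6)–(9.8), (10.4).
-/

noncomputable section

namespace Literature.Geometry.PolyhedralFans

open PointedCone

variable {κ : Type*} [Fintype κ]

/-- A **link** of a fan `Δ ⊆ ℚ^κ` ([KempfEtAl1973] II §1 Def. 5, the gluing data of a conical
polyhedral complex with integral structure, presented inside one ambient space): cones
`src, tgt ∈ Δ.cones` and `ℚ`-linear maps `toLin, invLin` of the ambient space restricting to
mutually inverse bijections `src ≅ tgt` that preserve lattice points.
[cite: KempfEtAl1973, Ch. II §1 Def. 5] -/
structure Fan.Link (Δ : Fan ℚ (κ → ℚ)) where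
  /-- the source cone -/
  src : PointedCone ℚ (κ → ℚ)
  /-- the target cone -/
  tgt : PointedCone ℚ (κ → ℚ)
  src_mem : src ∈ Δ.cones
  tgt_mem : tgt ∈ Δ.cones
  /-- the link map (only its restriction to `src` matters) -/
  toLin : (κ → ℚ) →ₗ[ℚ] (κ → ℚ)
  /-- an inverse on `tgt` -/
  invLin : (κ → ℚ) →ₗ[ℚ] (κ → ℚ)
  mapsTo : ∀ x ∈ src, toLin x ∈ tgt
  mapsTo_inv : ∀ x ∈ tgt, invLin x ∈ src
  left_inv : ∀ x ∈ src, invLin (toLin x) = x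
  right_inv : ∀ x ∈ tgt, toLin (invLin x) = x
  integral : ∀ x ∈ src, x ∈ latticeN κ → toLin x ∈ latticeN κ
  integral_inv : ∀ x ∈ tgt, x ∈ latticeN κ → invLin x ∈ latticeN κ

namespace Fan.Link

variable {Δ : Fan ℚ (κ → ℚ)} (ℓ : Δ.Link)

/-- The inverse link. [cite: KempfEtAl1973, Ch. II §1 Def. 5] -/
def symm : Δ.Link where
  src := ℓ.tgt
  tgt := ℓ.src
  src_mem := ℓ.tgt_mem
  tgt_mem := ℓ.src_mem
  toLin := ℓ.invLin
  invLin := ℓ.toLin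
  mapsTo := ℓ.mapsTo_inv
  mapsTo_inv := ℓ.mapsTo
  left_inv := ℓ.right_inv
  right_inv := ℓ.left_inv
  integral := ℓ.integral_inv
  integral_inv := ℓ.integral

omit [Fintype κ] in
/-- The link map carries `src` ONTO `tgt`. [cite: KempfEtAl1973, Ch. II §1 Def. 5] -/
theorem map_src : ℓ.src.map ℓ.toLin = ℓ.tgt := by
  ext y
  rw [PointedCone.mem_map]
  constructor
  · rintro ⟨x, hx, rfl⟩
    exact ℓ.mapsTo x hx
  · intro hy
    exact ⟨ℓ.invLin y, ℓ.mapsTo_inv y hy, ℓ.right_inv y hy⟩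

omit [Fintype κ] in
/-- The link map is injective on `src`. [cite: KempfEtAl1973, Ch. II §1 Def. 5] -/
theorem injOn : Set.InjOn ℓ.toLin ℓ.src := fun x hx x' hx' h => by
  rw [← ℓ.left_inv x hx, ← ℓ.left_inv x' hx', h]

end Fan.Link

/-- A refinement `Δ'` (of the fan carrying the link) is **compatible with the link `ℓ`** if the
link map carries every cone of `Δ'` inside `ℓ.src` to a cone of `Δ'` inside `ℓ.tgt` (applied to
`ℓ` and `ℓ.symm`: the subdivisions of the two identified cones correspond).
[cite: KempfEtAl1973, Ch. II §1 Def. 5 and §2] -/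
def Fan.LinkCompatible {Δ₀ : Fan ℚ (κ → ℚ)} (Δ' : Fan ℚ (κ → ℚ)) (ℓ : Δ₀.Link) : Prop :=
  ∀ ρ ∈ (Δ'.restrict ℓ.src).cones, ρ.map ℓ.toLin ∈ (Δ'.restrict ℓ.tgt).cones

/-- NAMED STATEMENT — **[KempfEtAl1973] Ch. II §2, Theorem 11* (regular projective subdivision of
a conical polyhedral complex with integral structure), presented by charts in one ambient space.**
For every rational fan `Δ₀ ⊆ ℚ^κ` and every set `L` of links of `Δ₀` there are finitely many
lattice star subdivisions `Δ' = Δ₀.starIter l` and ONE function `f ≥ 0` such that: `Δ'` refines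
`Δ₀` and is regular and simplicial; on every cone `σ` of `Δ₀` the cones of `Δ'` inside `σ` cover
`σ` and carry integral tight strict support data, non-negative on `σ`, whose minimum function is
`f` (verbatim `Fan.exists_regular_refinement_isStrictSupport_cones`); and `Δ'`, `f` are compatible
with every link of `L` and its inverse (`Fan.LinkCompatible`, `f ∘ ℓ = f` on `ℓ.src`). Users take
`(h : Fan.LinkedRegularRefinement)`. [cite: KempfEtAl1973, Ch. II §2 Thm. 11*] [cite: Kato1994, (9.8)] -/
def Fan.LinkedRegularRefinement : Prop :=
  ∀ (κ : Type) [Fintype κ] [DecidableEq κ] (Δ₀ : Fan ℚ (κ → ℚ)), Δ₀.IsRational →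
    ∀ L : Set Δ₀.Link,
    ∃ l : List (κ → ℚ), (∀ w ∈ l, w ∈ latticeN κ ∧ w ≠ 0) ∧
      (Δ₀.starIter l).Refines Δ₀ ∧ (Δ₀.starIter l).IsRegular ∧ (Δ₀.starIter l).IsSimplicial ∧
      ∃ f : (κ → ℚ) → ℚ, (∀ x, 0 ≤ f x) ∧
        (∀ ⦃σ : PointedCone ℚ (κ → ℚ)⦄, σ ∈ Δ₀.cones →
          ((Δ₀.starIter l).restrict σ).support = (σ : Set (κ → ℚ)) ∧
          ∃ m : PointedCone ℚ (κ → ℚ) → (κ → ℚ),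
            ((Δ₀.starIter l).restrict σ).IsStrictSupport m ∧
            ∀ τ ∈ ((Δ₀.starIter l).restrict σ).cones,
              m τ ∈ latticeN κ ∧ (∀ x ∈ σ, 0 ≤ m τ ⬝ᵥ x) ∧ (∀ x ∈ τ, m τ ⬝ᵥ x = f x)) ∧
        ∀ ℓ ∈ L, Fan.LinkCompatible (Δ₀.starIter l) ℓ ∧ Fan.LinkCompatible (Δ₀.starIter l) ℓ.symm ∧
          ∀ x ∈ ℓ.src, f (ℓ.toLin x) = f x

/-- **The link-free case is the tree theorem**: with no links, `Fan.LinkedRegularRefinement`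
specialises to `Fan.exists_regular_refinement_isStrictSupport_cones` (res-type-043).
[cite: KempfEtAl1973, Ch. I §2 Thm. 11] -/
theorem Fan.linkedRegularRefinement_empty (κ : Type) [Fintype κ] [DecidableEq κ]
    (Δ₀ : Fan ℚ (κ → ℚ)) (hΔ₀ : Δ₀.IsRational) :
    ∃ l : List (κ → ℚ), (∀ w ∈ l, w ∈ latticeN κ ∧ w ≠ 0) ∧
      (Δ₀.starIter l).Refines Δ₀ ∧ (Δ₀.starIter l).IsRegular ∧ (Δ₀.starIter l).IsSimplicial ∧
      ∃ f : (κ → ℚ) → ℚ, (∀ x, 0 ≤ f x) ∧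
        (∀ ⦃σ : PointedCone ℚ (κ → ℚ)⦄, σ ∈ Δ₀.cones →
          ((Δ₀.starIter l).restrict σ).support = (σ : Set (κ → ℚ)) ∧
          ∃ m : PointedCone ℚ (κ → ℚ) → (κ → ℚ),
            ((Δ₀.starIter l).restrict σ).IsStrictSupport m ∧
            ∀ τ ∈ ((Δ₀.starIter l).restrict σ).cones,
              m τ ∈ latticeN κ ∧ (∀ x ∈ σ, 0 ≤ m τ ⬝ᵥ x) ∧ (∀ x ∈ τ, m τ ⬝ᵥ x = f x)) ∧
        ∀ ℓ ∈ (∅ : Set Δ₀.Link), Fan.LinkCompatible (Δ₀.starIter l) ℓ ∧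
          Fan.LinkCompatible (Δ₀.starIter l) ℓ.symm ∧ ∀ x ∈ ℓ.src, f (ℓ.toLin x) = f x := by
  obtain ⟨l, hl, href, hreg, hsimp, f, hf, h⟩ :=
    Δ₀.exists_regular_refinement_isStrictSupport_cones hΔ₀
  exact ⟨l, hl, href, hreg, hsimp, f, hf, h, fun ℓ hℓ => absurd hℓ (Set.notMem_empty ℓ)⟩

/-! ## The same statement for a family of fans in their own coordinate spaces

This is the form consumed by the atlas form of Kato (10.4): chart `i` has its cone
`σ_i = P_i^∨ ⊆ ℚ^{n_i}`, and the links identify faces of `σ_i` and `σ_j` across `ℚ^{n_i} → ℚ^{n_j}`.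
(Placing the `ℚ^{n_i}` as coordinate blocks of one `ℚ^{Σ n_i}` turns a family into one fan with
links, so the family statement follows from `Fan.LinkedRegularRefinement`; that reduction is not
in this file.) -/

/-- A **link between two members of a family of fans** `Δ i ⊆ ℚ^{n i}`: cones `src ∈ (Δ i).cones`,
`tgt ∈ (Δ j).cones` and `ℚ`-linear maps `ℚ^{n i} ⇄ ℚ^{n j}` restricting to mutually inverse
lattice-preserving bijections `src ≅ tgt`. [cite: KempfEtAl1973, Ch. II §1 Def. 5] -/
structure Fan.FamilyLink {ι : Type*} (n : ι → ℕ) (Δ : ∀ i, Fan ℚ (Fin (n i) → ℚ)) where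
  /-- source member -/
  i : ι
  /-- target member -/
  j : ι
  /-- the source cone, a cone of `Δ i` -/
  src : PointedCone ℚ (Fin (n i) → ℚ)
  /-- the target cone, a cone of `Δ j` -/
  tgt : PointedCone ℚ (Fin (n j) → ℚ)
  src_mem : src ∈ (Δ i).cones
  tgt_mem : tgt ∈ (Δ j).cones
  /-- the link map (only its restriction to `src` matters) -/
  toLin : (Fin (n i) → ℚ) →ₗ[ℚ] (Fin (n j) → ℚ)
  /-- an inverse on `tgt` -/
  invLin : (Fin (n j) → ℚ) →ₗ[ℚ] (Fin (n i) → ℚ)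
  mapsTo : ∀ x ∈ src, toLin x ∈ tgt
  mapsTo_inv : ∀ x ∈ tgt, invLin x ∈ src
  left_inv : ∀ x ∈ src, invLin (toLin x) = x
  right_inv : ∀ x ∈ tgt, toLin (invLin x) = x
  integral : ∀ x ∈ src, x ∈ latticeN (Fin (n i)) → toLin x ∈ latticeN (Fin (n j))
  integral_inv : ∀ x ∈ tgt, x ∈ latticeN (Fin (n j)) → invLin x ∈ latticeN (Fin (n i))

/-- The inverse family link. [cite: KempfEtAl1973, Ch. II §1 Def. 5] -/
def Fan.FamilyLink.symm {ι : Type*} {n : ι → ℕ} {Δ : ∀ i, Fan ℚ (Fin (n i) → ℚ)}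
    (ℓ : Fan.FamilyLink n Δ) : Fan.FamilyLink n Δ where
  i := ℓ.j
  j := ℓ.i
  src := ℓ.tgt
  tgt := ℓ.src
  src_mem := ℓ.tgt_mem
  tgt_mem := ℓ.src_mem
  toLin := ℓ.invLin
  invLin := ℓ.toLin
  mapsTo := ℓ.mapsTo_inv
  mapsTo_inv := ℓ.mapsTo
  left_inv := ℓ.right_inv
  right_inv := ℓ.left_inv
  integral := ℓ.integral_inv
  integral_inv := ℓ.integral

/-- Compatibility of a family of refinements `Δ' i` with a family link: the link map carries the
cones of `Δ' ℓ.i` inside `ℓ.src` to cones of `Δ' ℓ.j` inside `ℓ.tgt`.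
[cite: KempfEtAl1973, Ch. II §1 Def. 5 and §2] -/
def Fan.FamilyLinkCompatible {ι : Type*} {n : ι → ℕ} {Δ : ∀ i, Fan ℚ (Fin (n i) → ℚ)}
    (Δ' : ∀ i, Fan ℚ (Fin (n i) → ℚ)) (ℓ : Fan.FamilyLink n Δ) : Prop :=
  ∀ ρ ∈ ((Δ' ℓ.i).restrict ℓ.src).cones, ρ.map ℓ.toLin ∈ ((Δ' ℓ.j).restrict ℓ.tgt).cones

/-- NAMED STATEMENT — **[KempfEtAl1973] Ch. II §2, Theorem 11* for a FAMILY of fans glued by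
links** (each `Δ₀ i ⊆ ℚ^{n i}` in its own coordinates; the form used by the atlas form of Kato
(10.4), with `Δ₀ i` the face fan of `P_i^∨`): simultaneous regular simplicial refinements
`(Δ₀ i).starIter (l i)` with functions `f i ≥ 0` satisfying, member by member, the conclusion of
`Fan.exists_regular_refinement_isStrictSupport_cones`, compatible with every link and its inverse
(`Fan.FamilyLinkCompatible`, `f j ∘ ℓ = f i` on `ℓ.src`). Users take
`(h : Fan.LinkedRegularRefinementFamily)`. [cite: KempfEtAl1973, Ch. II §2 Thm. 11*] [cite: Kato1994, (9.8)] -/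
def Fan.LinkedRegularRefinementFamily : Prop :=
  ∀ (ι : Type) [Fintype ι] (n : ι → ℕ) (Δ₀ : ∀ i, Fan ℚ (Fin (n i) → ℚ)),
    (∀ i, (Δ₀ i).IsRational) → ∀ L : Set (Fan.FamilyLink n Δ₀),
    ∃ (l : ∀ i, List (Fin (n i) → ℚ)) (f : ∀ i, (Fin (n i) → ℚ) → ℚ),
      (∀ i, (∀ w ∈ l i, w ∈ latticeN (Fin (n i)) ∧ w ≠ 0) ∧
        ((Δ₀ i).starIter (l i)).Refines (Δ₀ i) ∧ ((Δ₀ i).starIter (l i)).IsRegular ∧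
        ((Δ₀ i).starIter (l i)).IsSimplicial ∧ (∀ x, 0 ≤ f i x) ∧
        ∀ ⦃σ : PointedCone ℚ (Fin (n i) → ℚ)⦄, σ ∈ (Δ₀ i).cones →
          (((Δ₀ i).starIter (l i)).restrict σ).support = (σ : Set (Fin (n i) → ℚ)) ∧
          ∃ m : PointedCone ℚ (Fin (n i) → ℚ) → (Fin (n i) → ℚ),
            (((Δ₀ i).starIter (l i)).restrict σ).IsStrictSupport m ∧
            ∀ τ ∈ (((Δ₀ i).starIter (l i)).restrict σ).cones,
              m τ ∈ latticeN (Fin (n i)) ∧ (∀ x ∈ σ, 0 ≤ m τ ⬝ᵥ x) ∧ (∀ x ∈ τ, m τ ⬝ᵥ x = f i x)) ∧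
      ∀ ℓ ∈ L, Fan.FamilyLinkCompatible (fun i => (Δ₀ i).starIter (l i)) ℓ ∧
        Fan.FamilyLinkCompatible (fun i => (Δ₀ i).starIter (l i)) ℓ.symm ∧
        ∀ x ∈ ℓ.src, f ℓ.j (ℓ.toLin x) = f ℓ.i x

/-- **The link-free case of the family statement is the tree theorem, member by member.**
[cite: KempfEtAl1973, Ch. I §2 Thm. 11] -/
theorem Fan.linkedRegularRefinementFamily_empty (ι : Type) [Fintype ι] (n : ι → ℕ)
    (Δ₀ : ∀ i, Fan ℚ (Fin (n i) → ℚ)) (hΔ₀ : ∀ i, (Δ₀ i).IsRational) :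
    ∃ (l : ∀ i, List (Fin (n i) → ℚ)) (f : ∀ i, (Fin (n i) → ℚ) → ℚ),
      (∀ i, (∀ w ∈ l i, w ∈ latticeN (Fin (n i)) ∧ w ≠ 0) ∧
        ((Δ₀ i).starIter (l i)).Refines (Δ₀ i) ∧ ((Δ₀ i).starIter (l i)).IsRegular ∧
        ((Δ₀ i).starIter (l i)).IsSimplicial ∧ (∀ x, 0 ≤ f i x) ∧
        ∀ ⦃σ : PointedCone ℚ (Fin (n i) → ℚ)⦄, σ ∈ (Δ₀ i).cones →
          (((Δ₀ i).starIter (l i)).restrict σ).support = (σ : Set (Fin (n i) → ℚ)) ∧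
          ∃ m : PointedCone ℚ (Fin (n i) → ℚ) → (Fin (n i) → ℚ),
            (((Δ₀ i).starIter (l i)).restrict σ).IsStrictSupport m ∧
            ∀ τ ∈ (((Δ₀ i).starIter (l i)).restrict σ).cones,
              m τ ∈ latticeN (Fin (n i)) ∧ (∀ x ∈ σ, 0 ≤ m τ ⬝ᵥ x) ∧ (∀ x ∈ τ, m τ ⬝ᵥ x = f i x)) ∧
      ∀ ℓ ∈ (∅ : Set (Fan.FamilyLink n Δ₀)),
        Fan.FamilyLinkCompatible (fun i => (Δ₀ i).starIter (l i)) ℓ ∧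
        Fan.FamilyLinkCompatible (fun i => (Δ₀ i).starIter (l i)) ℓ.symm ∧
        ∀ x ∈ ℓ.src, f ℓ.j (ℓ.toLin x) = f ℓ.i x := by
  classical
  have h := fun i => (Δ₀ i).exists_regular_refinement_isStrictSupport_cones (hΔ₀ i)
  choose l hl href hreg hsimp f hf h using h
  exact ⟨l, f, fun i => ⟨hl i, href i, hreg i, hsimp i, hf i, h i⟩,
    fun ℓ hℓ => absurd hℓ (Set.notMem_empty ℓ)⟩

end Literature.Geometry.PolyhedralFans
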